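import Literature.AlgebraicGeometry.Motives.CyclesDimensionFunctionField
import Literature.AlgebraicGeometry.Motives.SegreEmbedding
import Mathlib.AlgebraicGeometry.IdealSheaf.Subscheme
import Mathlib.AlgebraicGeometry.Pullbacks
import Mathlib.AlgebraicGeometry.Geometrically.Integral
import Mathlib.RingTheory.PolynomialAlgebra
import HarnessLib

/-!
# The closure of the graph of a rational function, and `dim (Y ×_k ℙ¹) = dim Y + 1`

Two geometric inputs for Fulton, *Intersection Theory*, Prop. 1.4 (a) (`f_*[div(r)] = 0` for
`f : X → Y` proper surjective with `dim Y = dim X - 1`), whose printed proof replaces `X` by a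
curve over `K = R(Y)`, normalises, and chooses "a finite morphism `g : X̃ → ℙ¹_K`".  Working over
the base `Y` itself we replace the normalisation by the closure `X'` of the graph of `r`:

* `Literature.AlgebraicGeometry.Motives.exists_graphClosure` — for `X` integral over a field `k`,
  `r ∈ R(X)^*` transcendental over `k` and a proper integral `k`-scheme `P` equipped with a
  rational function `t` and "coordinate" morphisms `U → P` (as `ℙ¹_k` is, by
  `Motives/ProjectiveLineInvolution`): an integral scheme `X'` with a proper dominant birational
  `π : X' → X` and a dominant `k`-morphism `ψ : X' → P` with `ψ^♯ t = π^♯ r` — the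
  scheme-theoretic image (Mathlib `Scheme.Hom.image`) of the graph `U → X ×_k P` over an affine
  open `U` where `r` is regular; with the lemma `functionFieldMap_bijective_of_isOpenImmersion`
  (the scheme-theoretic image of an integral scheme is integral by
  `Literature.AlgebraicGeometry.Motives.isIntegral_image_of_isIntegral` of
  `Motives/CyclesPushforwardFacts`; dominance of `g` from dominance of `f ≫ g` is Mathlib's
  `IsDominant.of_comp`);
* `Literature.AlgebraicGeometry.Motives.height_top_pullback_eq_add_one` —
  `dim (Y ×_k P) = dim Y + 1` when `P → Spec k` is geometrically integral with an open chart `Spec k[T]` (the affine open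
  `Spec (R ⊗_k k[T]) = Spec R[T]` over an affine `Spec R ⊆ Y` has dimension `dim R + 1`).

Everything here is proved.

## References

* [Fulton1998] W. Fulton, *Intersection Theory*, 2nd ed. (1998), Prop. 1.4 (a), proof.
* [Hartshorne1977] R. Hartshorne, *Algebraic Geometry* (1977), II Ex. 3.11 (d) / Ex. 4.2
  (scheme-theoretic image, graph of a morphism).
-/

open CategoryTheory AlgebraicGeometry Order Topology TopologicalSpace Limits
open scoped TensorProduct

universe u

noncomputable section

namespace Literature.AlgebraicGeometry.Motives

/-! ### Function fields along open immersions -/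

/-- The map of function fields along an open immersion of integral schemes is bijective.
[folklore] -/
theorem functionFieldMap_bijective_of_isOpenImmersion {X Y : Scheme.{u}} [IsIntegral X]
    [IsIntegral Y] (f : X ⟶ Y) [IsOpenImmersion f] [IsDominant f] :
    Function.Bijective (RatFn.functionFieldMap f) := by
  have hη : f.base (genericPoint X) = genericPoint Y := genericPoint_eq_of_isOpenImmersion f
  haveI : IsIso (Y.presheaf.stalkSpecializes (RatFn.specializes_genericPoint f)) := by
    have key : ∀ (y : Y) (h : y ⤳ genericPoint Y), y = genericPoint Y →
        IsIso (Y.presheaf.stalkSpecializes h) := by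
      rintro y h rfl
      rw [show Y.presheaf.stalkSpecializes h = 𝟙 _ from
        TopCat.Presheaf.stalkSpecializes_refl _ _]
      infer_instance
    exact key _ _ hη
  haveI : IsIso (Y.presheaf.stalkSpecializes (RatFn.specializes_genericPoint f) ≫
      f.stalkMap (genericPoint X)) := IsIso.comp_isIso
  exact ConcreteCategory.bijective_of_isIso
    (Y.presheaf.stalkSpecializes (RatFn.specializes_genericPoint f) ≫ f.stalkMap (genericPoint X))

/-! ### The closure of the graph of a rational function -/

/-- **The closure of the graph of a rational function.** Let `X` be an integral scheme over a field
`k`, `r ∈ R(X)^*` transcendental over `k`, and `P` a proper integral `k`-scheme with a rational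
function `t` and `k`-morphisms `ρ_a : U → P` ("`(1 : a)`") for functions `a` on affine integral
`k`-schemes `U`, dominant for transcendental `a`, with `ρ_a^♯ t = a` (as provided for `P = ℙ¹_k` by
`Motives/ProjectiveLineInvolution`). Then there are an integral scheme `X'`, a proper dominant
*birational* morphism `π : X' → X` (`π^♯ : R(X) ≅ R(X')`) and a dominant `k`-morphism `ψ : X' → P`
with `ψ^♯ t = π^♯ r`: `X'` is the scheme-theoretic image (Mathlib `Scheme.Hom.image`) of the graph
`U → X ×_k P` of `ρ_{r|U}` on an affine open `U` where `r` is regular (Fulton, *Intersection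
Theory*, Prop. 1.4 (a), proof: the normalisation `X̃ → X` and "a finite morphism `g : X̃ → ℙ¹_K`",
replaced here by the graph closure, which needs no finiteness of normalisation).
[cite: Fulton1998, Prop. 1.4 (a), proof] -/
theorem exists_graphClosure {k : Type u} [Field k] {X : Scheme.{u}} [IsIntegral X]
    [IsLocallyNoetherian X] (fX : X ⟶ Spec (.of k)) (r : X.functionField) (hr : r ≠ 0)
    (htr : letI := ((X.presheaf.germ ⊤ (genericPoint X) trivial).hom.comp
        (fX.appTop.hom.comp (Scheme.ΓSpecIso (.of k)).inv.hom)).toAlgebra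
      Transcendental k r)
    {P : Scheme.{u}} [IsIntegral P] (toS : P ⟶ Spec (.of k)) [IsProper toS]
    (t : P.functionField)
    (huniv : ∀ (U : Scheme.{u}) [IsIntegral U] [IsAffine U] (u : U ⟶ Spec (.of k))
        (a : Γ(U, ⊤)), ∃ ρ : U ⟶ P, ρ ≫ toS = u ∧
          ((letI := (Segre.pull u).toAlgebra; Transcendental k a) → IsDominant ρ) ∧
          ∀ [IsDominant ρ],
            RatFn.functionFieldMap ρ t = U.presheaf.germ ⊤ (genericPoint U) trivial a) :
    ∃ (X' : Scheme.{u}) (_ : IsIntegral X') (π : X' ⟶ X) (_ : IsProper π) (_ : IsDominant π)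
      (ψ : X' ⟶ P) (_ : IsDominant ψ), ψ ≫ toS = π ≫ fX ∧
      Function.Bijective (RatFn.functionFieldMap π) ∧
      RatFn.functionFieldMap ψ t = RatFn.functionFieldMap π r := by
  -- an affine open `U` on which `r` is a regular function `f'`
  obtain ⟨U, hUaff, f', hne, hf'r, -⟩ := exists_isUnit_germ_eq X r hr
  have hU : IsAffineOpen U := hUaff
  haveI : IsAffine U := hU
  haveI : Nonempty U := hne
  let u : (U : Scheme.{u}) ⟶ Spec (.of k) := U.ι ≫ fX
  let a : Γ(U, ⊤) := U.topIso.inv f'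
  obtain ⟨ρ, hρS, hρdom, hρt⟩ := huniv U u a
  -- `a ↦ r` under the injective `k`-algebra map `Γ(U, 𝒪_U) → R(X)`, so `a` is transcendental
  have ha : (letI := (Segre.pull u).toAlgebra; Transcendental k a) := by
    letI algU := (Segre.pull u).toAlgebra
    letI algX := ((X.presheaf.germ ⊤ (genericPoint X) trivial).hom.comp
        (fX.appTop.hom.comp (Scheme.ΓSpecIso (.of k)).inv.hom)).toAlgebra
    let θ : Γ(U, ⊤) →ₐ[k] X.functionField :=
      { toRingHom := (X.germToFunctionField U).hom.comp U.topIso.hom.hom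
        commutes' := fun c ↦ by
          change X.germToFunctionField U (U.topIso.hom (U.ι.appTop (fX.appTop _))) =
            X.presheaf.germ ⊤ (genericPoint X) trivial (fX.appTop _)
          have h1 : U.topIso.hom (U.ι.appTop (fX.appTop ((Scheme.ΓSpecIso (.of k)).inv c))) =
              X.presheaf.map (homOfLE le_top).op
                (fX.appTop ((Scheme.ΓSpecIso (.of k)).inv c)) := by
            simp only [Scheme.Opens.topIso_hom, Scheme.Opens.ι_appTop]
            rw [← CommRingCat.comp_apply]
            erw [← X.presheaf.map_comp]
            rfl
          erw [h1]
          rw [Scheme.germToFunctionField, TopCat.Presheaf.germ_res_apply] }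
    have hθ : Function.Injective θ :=
      (X.germToFunctionField_injective U).comp U.topIso.commRingCatIsoToRingEquiv.injective
    have hθa : θ a = r := by
      change X.germToFunctionField U (U.topIso.hom (U.topIso.inv f')) = r
      rw [CategoryTheory.Iso.inv_hom_id_apply, hf'r]
    intro halg
    exact htr (hθa ▸ halg.algHom θ)
  haveI : IsDominant ρ := hρdom ha
  -- the graph of `ρ` in `X ×_k P` and its scheme-theoretic image
  let γ : (U : Scheme.{u}) ⟶ pullback fX toS := pullback.lift U.ι ρ (by rw [hρS])
  haveI : QuasiCompact γ := inferInstance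
  haveI hX' : IsIntegral γ.image := isIntegral_image_of_isIntegral γ
  have hγ₁ : γ ≫ pullback.fst fX toS = U.ι := pullback.lift_fst _ _ _
  have hγ₂ : γ ≫ pullback.snd fX toS = ρ := pullback.lift_snd _ _ _
  -- `π : X' → X` is proper and dominant, `ψ : X' → P` is dominant
  haveI : IsDominant U.ι := by
    -- an open immersion between irreducible schemes is dominant
    refine ⟨?_⟩
    rw [denseRange_iff_closure_range]
    apply Set.eq_univ_of_univ_subset
    rw [← (genericPoint_spec X : closure {genericPoint X} = Set.univ)]
    apply closure_mono
    rw [Set.singleton_subset_iff, ← genericPoint_eq_of_isOpenImmersion U.ι]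
    exact Set.mem_range_self _
  haveI : IsDominant (γ.toImage ≫ γ.imageι ≫ pullback.fst fX toS) := by
    rw [Scheme.Hom.toImage_imageι_assoc, hγ₁]; infer_instance
  haveI hπd : IsDominant (γ.imageι ≫ pullback.fst fX toS) := IsDominant.of_comp γ.toImage _
  haveI : IsDominant (γ.toImage ≫ γ.imageι ≫ pullback.snd fX toS) := by
    rw [Scheme.Hom.toImage_imageι_assoc, hγ₂]; infer_instance
  haveI hψd : IsDominant (γ.imageι ≫ pullback.snd fX toS) := IsDominant.of_comp γ.toImage _
  haveI hπp : IsProper (γ.imageι ≫ pullback.fst fX toS) := inferInstance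
  -- functoriality of `(-)^♯` along `toImage ≫ π = U.ι` and `toImage ≫ ψ = ρ`
  have hcongr : ∀ {Z : Scheme.{u}} [IsIntegral Z] {f g : (U : Scheme.{u}) ⟶ Z} [IsDominant f]
      [IsDominant g], f = g → RatFn.functionFieldMap f = RatFn.functionFieldMap g := by
    intro Z _ f g _ _ h; subst h; rfl
  have hπsharp : (RatFn.functionFieldMap γ.toImage).comp
      (RatFn.functionFieldMap (γ.imageι ≫ pullback.fst fX toS)) = RatFn.functionFieldMap U.ι := by
    rw [← RatFn.functionFieldMap_comp, hcongr (by rw [Scheme.Hom.toImage_imageι_assoc, hγ₁])]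
  have hψsharp : (RatFn.functionFieldMap γ.toImage).comp
      (RatFn.functionFieldMap (γ.imageι ≫ pullback.snd fX toS)) = RatFn.functionFieldMap ρ := by
    rw [← RatFn.functionFieldMap_comp, hcongr (by rw [Scheme.Hom.toImage_imageι_assoc, hγ₂])]
  have hιbij := functionFieldMap_bijective_of_isOpenImmersion U.ι
  refine ⟨γ.image, hX', γ.imageι ≫ pullback.fst fX toS, hπp, hπd, γ.imageι ≫ pullback.snd fX toS,
    hψd, ?_, ?_, ?_⟩
  · simp only [Category.assoc, pullback.condition]
  · refine ⟨RingHom.injective _, fun y ↦ ?_⟩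
    obtain ⟨x, hx⟩ := hιbij.2 (RatFn.functionFieldMap γ.toImage y)
    refine ⟨x, (RatFn.functionFieldMap γ.toImage).injective ?_⟩
    rw [← hx, ← RingHom.comp_apply, hπsharp]
  · apply (RatFn.functionFieldMap γ.toImage).injective
    rw [← RingHom.comp_apply, hψsharp, ← RingHom.comp_apply, hπsharp, hρt, ← hf'r]
    -- both sides are the germ of `f'` at the generic point of `U`
    have hmem : U.ι.base (genericPoint U) ∈ U := (genericPoint (U : Scheme.{u})).2
    haveI : Nonempty (U.ι ⁻¹ᵁ U) := ⟨⟨_, hmem⟩⟩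
    rw [functionFieldMap_germToFunctionField U.ι U f' (genericPoint U) hmem]
    have key : U.ι.app U f' =
        (U : Scheme.{u}).presheaf.map (eqToHom U.ι_preimage_self).op (U.topIso.inv f') := by
      simp only [Scheme.Opens.topIso_inv, Scheme.Opens.ι_app]
      rw [← CommRingCat.comp_apply]
      erw [← X.presheaf.map_comp]
      rfl
    rw [key, Scheme.germToFunctionField, TopCat.Presheaf.germ_res_apply]


/-- **`dim (Y ×_k P) = dim Y + 1` for `P` containing the affine line as an open chart**, e.g.
`P = ℙ¹_k`: for `Y` integral, locally Noetherian and locally of finite type over a field `k` with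
`dim Y = n`, and `P → Spec k` geometrically integral, flat, universally open and locally of finite
type with an open immersion `Spec k[T] ↪ P` over `k`, the integral scheme `Y ×_k P` has dimension
`n + 1`: it contains the affine open `Spec (R ⊗_k k[T]) = Spec R[T]` for an affine open
`Spec R ⊆ Y`, of dimension `dim R + 1 = n + 1` (`dim R[T] = dim R + 1` for Noetherian `R`), and
the dimension of an integral scheme locally of finite type over a field is that of any affine
chart (`Literature.AlgebraicGeometry.Motives.height_top_eq_ringKrullDim`). [folklore] -/
theorem height_top_pullback_eq_add_one {k : Type u} [Field k] {P : Scheme.{u}}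
    (toS : P ⟶ Spec (.of k)) [GeometricallyIntegral toS] [Flat toS] [UniversallyOpen toS]
    [LocallyOfFiniteType toS] (j : Spec (.of (Polynomial k)) ⟶ P) [IsOpenImmersion j]
    (hj : j ≫ toS = Spec.map (CommRingCat.ofHom (algebraMap k (Polynomial k))))
    {Y : Scheme.{u}} [IsIntegral Y] [IsLocallyNoetherian Y] (g : Y ⟶ Spec (.of k))
    [LocallyOfFiniteType g] (n : ℕ) (hY : height (⊤ : Y) = n) :
    height (⊤ : ↥(pullback g toS)) = n + 1 := by
  -- an affine chart `Spec R` of `Y`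
  obtain ⟨_, ⟨U, hU, rfl⟩, hηU, -⟩ :=
    Y.isBasis_affineOpens.exists_subset_of_mem_open (Set.mem_univ (⊤ : Y)) isOpen_univ
  have hU : IsAffineOpen U := hU
  haveI : Nonempty U := ⟨⟨⊤, hηU⟩⟩
  haveI : IsNoetherianRing Γ(Y, U) := IsLocallyNoetherian.component_noetherian ⟨U, hU⟩
  let φ₁ : CommRingCat.of k ⟶ Γ(Y, U) := Spec.preimage (hU.fromSpec ≫ g)
  letI : Algebra k Γ(Y, U) := φ₁.hom.toAlgebra
  have e₁ : hU.fromSpec ≫ g = Spec.map (CommRingCat.ofHom (algebraMap k Γ(Y, U))) := by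
    rw [RingHom.algebraMap_toAlgebra, CommRingCat.ofHom_hom]; exact (Spec.map_preimage _).symm
  -- the affine open `Spec (R ⊗ k[T]) = Spec R[T]` of `Y ×_k P`
  let α := pullback.map (hU.fromSpec ≫ g) (j ≫ toS) g toS hU.fromSpec j (𝟙 _)
    (Category.comp_id _) (Category.comp_id _)
  haveI : IsOpenImmersion α := inferInstance
  let ι₁ := pullback.congrHom e₁ hj ≪≫ pullbackSpecIso k Γ(Y, U) (Polynomial k)
  haveI : IsAffine (pullback (hU.fromSpec ≫ g) (j ≫ toS)) := IsAffine.of_isIso ι₁.hom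
  have hW : IsAffineOpen (α ''ᵁ ⊤) := by
    rw [Scheme.Hom.image_top_eq_opensRange]; exact isAffineOpen_opensRange α
  -- the ring of the chart is `R[T]`
  let eR : Γ(pullback g toS, α ''ᵁ ⊤) ≃+* Polynomial Γ(Y, U) :=
    (α.appIso ⊤ ≪≫ (Scheme.Γ.mapIso ι₁.op).symm ≪≫
      Scheme.ΓSpecIso (.of (Γ(Y, U) ⊗[k] Polynomial k))).commRingCatIsoToRingEquiv.trans
      (polyEquivTensor' k Γ(Y, U)).symm.toRingEquiv
  haveI : Nonempty (α ''ᵁ ⊤ : (pullback g toS).Opens) := by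
    haveI : Nontrivial (Γ(Y, U) ⊗[k] Polynomial k) :=
      (polyEquivTensor' k Γ(Y, U)).symm.toEquiv.nontrivial
    obtain ⟨x₀⟩ := (inferInstance : Nonempty (Spec (.of (Γ(Y, U) ⊗[k] Polynomial k))))
    exact ⟨⟨α.base (ι₁.inv.base x₀), ⟨ι₁.inv.base x₀, trivial, rfl⟩⟩⟩
  -- dimensions
  haveI : IsIntegral (pullback g toS) := inferInstance
  have hZ := height_top_eq_ringKrullDim (pullback.fst g toS ≫ g) hW
  have hYd := height_top_eq_ringKrullDim g hU
  rw [eR.ringKrullDim, Polynomial.ringKrullDim_of_isNoetherianRing, ← hYd, hY] at hZ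
  have : ((height (⊤ : ↥(pullback g toS)) : ℕ∞) : WithBot ℕ∞) = ((n + 1 : ℕ∞) : WithBot ℕ∞) := by
    rw [hZ]; rfl
  exact_mod_cast this

end Literature.AlgebraicGeometry.Motives

end
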